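import Summits.BirchSwinnertonDyer.BirchSwinnertonDyer.Theorems.Rank2Observatory2DescClRowCertLe
import HarnessLib

/-!
# BirchSwinnertonDyer — rank ≥ 2 observatory: the SUBGROUP SIEVE for the cubic-field 2-descent (KERNEL-2DESC-CL v2.8)

HONEST FRAMING: per-curve certified theorems and census instruments; no claim on BSD in rank ≥ 2.

The rank bound of every landed 2-descent checker is the COUNT `#(surviving classes) < 2^(r+1) ⇒ rank E(ℚ) ≤ r`
(`TwoDescCubic.mordellWeilRank_le_of_sqClass_cover_lt`).  But the image of the descent homomorphism
`μ : E(ℚ) → K×/K×²` is a SUBGROUP of the surviving classes, and `2^rank ≤ #μ(E(ℚ))`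
(`two_pow_finrank_le_card`).  Hence the sharper, still kernel-decidable criterion of this file:

* `TwoDescCubic.mordellWeilRank_le_of_sqClass_cover_noSub` — if every multiplicatively closed `H ∋ 1` inside the
  cover `S` has `#H < 2^(s+1)`, then `rank E(ℚ) ≤ s`;
* `noSubB surv S k [∅]` — the Boolean search run by `decide +kernel`: extend the span `cs` (initially `[∅]`) by any
  surviving class `U ∉ cs` (`cs ↦ cs ++ (U ∆ cs)`), `k` times; succeed iff every branch meets a non-surviving
  class.  `card_lt_of_noSubB`: then every `∆`-closed family of surviving classes containing `∅` has fewer than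
  `2^k` members (halving induction: a closed family not inside `cs` contains some `U ∉ cs`, and `cs ++ (U ∆ cs)`
  stays inside the family);
* `mordellWeilRank_le_of_coverSet_cl_noSub` — the class-group-general cover theorem
  (`mordellWeilRank_le_of_coverSet_cl_lt`) with the count replaced by `noSubB (adm ∅ ·) S (s'+1) [∅] = true`
  for any list `S` containing the admissible classes, GIVEN that the family `W` is independent modulo squares
  (the parity certificate every v2.x checker already verifies): a closed `H ⊆ coverSet` pulls back to a
  `∆`-closed admissible family of the same size because `U ↦ (∏_U W)·K×²` is then an injective homomorphism.

Why it matters: the admissible classes form (in practice) a subgroup `A` of `2^d` classes and the image has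
`2^rank` of them; with the count, a `d = 4` row of a rank-2 curve needs NINE killed classes (`16 − 9 < 8`), with
the subgroup sieve THREE (`c₁, c₂, c₁c₂` outside the image meet every subgroup of order 8), a `d = 5` row 7
instead of 25.  For `d = 3` rows (one kill) the two criteria coincide.  The per-curve checkers using it are
`…2DescClSubCurveCertE2{Defs,,Rows}` (v2.8).
Sorry-free; axioms `propext`, `Classical.choice`, `Quot.sound`.
[cite: Cassels1991LecturesEllipticCurves, §15] [cite: CremonaAlgorithms1997, §3.6]
-/

set_option linter.dupNamespace false

noncomputable section

open scoped NumberField nonZeroDivisors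

open Literature.NumberTheory.NumberFields Literature.NumberTheory.EllipticCurves Polynomial Module NumberField
open IsDedekindDomain Ideal WeierstrassCurve.Affine

/-! ## The abstract rank bound: no large subgroup inside the cover -/

namespace Summit.BirchSwinnertonDyer.BirchSwinnertonDyer.Rank2Observatory.TwoDescCubic

section RankBound

variable {F K : Type*} [Field F] [NumberField F] [Field K] [CharZero K]

/-- Rank bound of the cubic-field descent, SUBGROUP form: if the classes `(φ x − e)·K×²` of all `F`-points lie in
a finite set `S ∋ 1` every multiplicatively closed subset `H ∋ 1` of which has `#H < 2^(s+1)`, then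
`rank E(F) ≤ s` — because the image of the descent homomorphism is such an `H` and `2^rank ≤ #image`.
[cite: Cassels1991LecturesEllipticCurves, §15] -/
theorem mordellWeilRank_le_of_sqClass_cover_noSub (W : WeierstrassCurve F) [W.IsElliptic] (φ : F →+* K)
    {e : K} (ha₁ : W.a₁ = 0) (ha₃ : W.a₃ = 0)
    (hroot : e ^ 3 + φ W.a₂ * e ^ 2 + φ W.a₄ * e + φ W.a₆ = 0)
    (hlin : ∀ c₀ c₁ c₂ : F, φ c₂ * e ^ 2 + φ c₁ * e + φ c₀ = 0 → c₀ = 0 ∧ c₁ = 0 ∧ c₂ = 0)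
    (hspan : ∀ z : K, ∃ c₀ c₁ c₂ : F, z = φ c₂ * e ^ 2 + φ c₁ * e + φ c₀)
    (S : Finset (SqUnits K)) (h1 : (1 : SqUnits K) ∈ S)
    (hS : ∀ x y : F, W.toAffine.Nonsingular x y → sqClass (φ x - e) ∈ S)
    {s : ℕ} (hsub : ∀ H : Finset (SqUnits K), H ⊆ S → (1 : SqUnits K) ∈ H →
      (∀ a ∈ H, ∀ b ∈ H, a * b ∈ H) → H.card < 2 ^ (s + 1)) : W.mordellWeilRank ≤ s := by
  classical
  haveI : Module.Finite ℤ W.toAffine.Point := W.module_finite_point_holds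
  set ψ := muHom W.toAffine φ e (two_division_cubic_of_a ha₁ ha₃ hroot) (ne_of_powIndep hlin)
    with hψ
  have hker : ∀ P : W.toAffine.Point, ψ P = 0 → ∃ Q : W.toAffine.Point, P = 2 • Q :=
    fun P hP => muHom_ker_le ha₁ ha₃ hroot hlin hspan P hP
  have hS' : ∀ P : W.toAffine.Point, Additive.toMul (ψ P) ∈ S := by
    intro P
    rcases P with _ | @⟨x, y, h⟩
    · show Additive.toMul (Additive.ofMul (muMap W.toAffine φ e 0)) ∈ S
      rw [muMap_zero]
      exact h1
    · simpa only [hψ, muHom_apply, muMap_some, toMul_ofMul] using hS x y h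
  let H : Finset (SqUnits K) := S.filter (fun c => ∃ P : W.toAffine.Point, Additive.toMul (ψ P) = c)
  have hH : ∀ P : W.toAffine.Point, ψ P ∈ H.map (Equiv.toEmbedding Additive.ofMul) := by
    intro P
    rw [Finset.mem_map_equiv]
    exact Finset.mem_filter.mpr ⟨hS' P, P, rfl⟩
  have hb := two_pow_finrank_le_card ψ hker (H.map (Equiv.toEmbedding Additive.ofMul)) hH
  rw [Finset.card_map] at hb
  have hHS : H ⊆ S := Finset.filter_subset _ _
  have hH1 : (1 : SqUnits K) ∈ H := by
    refine Finset.mem_filter.mpr ⟨h1, 0, ?_⟩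
    rw [map_zero]
    rfl
  have hHmul : ∀ a ∈ H, ∀ b ∈ H, a * b ∈ H := by
    intro a ha b hb'
    obtain ⟨-, P, hP⟩ := Finset.mem_filter.mp ha
    obtain ⟨-, Q, hQ⟩ := Finset.mem_filter.mp hb'
    have hPQ : Additive.toMul (ψ (P + Q)) = a * b := by
      rw [map_add, toMul_add, hP, hQ]
    refine Finset.mem_filter.mpr ⟨?_, P + Q, hPQ⟩
    rw [← hPQ]
    exact hS' (P + Q)
  rw [WeierstrassCurve.mordellWeilRank]
  exact Nat.lt_succ_iff.mp ((pow_lt_pow_iff_right₀ (by norm_num : (1 : ℕ) < 2)).mp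
    (hb.trans_lt (hsub H hHS hH1 hHmul)))

end RankBound

end Summit.BirchSwinnertonDyer.BirchSwinnertonDyer.Rank2Observatory.TwoDescCubic

namespace Summit.BirchSwinnertonDyer.BirchSwinnertonDyer.Rank2Observatory.TwoDescCl

open TwoDescCubic

/-! ## `∆`-closed families of index sets: the kernel search and its counting consequence -/

section Family

variable {n : ℕ}

/-- **The subgroup-sieve search.** `noSubB surv S k cs`: starting from the list `cs` (a span; initially `[∅]`),
either some member of `cs` already fails `surv`, or (`k > 0`) for EVERY `U ∈ S` not in `cs` the extended span
`cs ++ cs.map (U ∆ ·)` passes `noSubB surv S (k−1)`.  `S` is any list containing the surviving classes.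
Run by `decide +kernel`. [folklore] -/
def noSubB (surv : Finset (Fin n) → Bool) (S : List (Finset (Fin n))) : ℕ → List (Finset (Fin n)) → Bool
  | 0, cs => !(cs.all surv)
  | k + 1, cs => !(cs.all surv) || S.all fun U => decide (U ∈ cs) || noSubB surv S k (cs ++ cs.map (symmDiff U))

/-- **Counting consequence of the search**: if `noSubB surv S k cs` succeeds, every `∆`-closed family `P ∋ ∅` of
surviving classes, listed in `S` and containing `cs`, has `#P < 2^k · |cs|`.  (Halving induction: either
`P ⊆ cs`, or some `U ∈ P ∖ cs` extends `cs` inside `P`.) [folklore] -/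
theorem card_lt_of_noSubB (surv : Finset (Fin n) → Bool) (S : List (Finset (Fin n)))
    (P : Finset (Finset (Fin n))) (h0 : ∅ ∈ P) (hsurv : ∀ U ∈ P, surv U = true) (hS : ∀ U ∈ P, U ∈ S)
    (hclosed : ∀ U ∈ P, ∀ V ∈ P, symmDiff U V ∈ P) :
    ∀ (k : ℕ) (cs : List (Finset (Fin n))), (∀ V ∈ cs, V ∈ P) → noSubB surv S k cs = true →
      P.card < 2 ^ k * cs.length := by
  classical
  intro k
  induction k with
  | zero =>
    intro cs hcs h
    have hall : cs.all surv = true := List.all_eq_true.mpr fun V hV => hsurv V (hcs V hV)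
    simp [noSubB, hall] at h
  | succ k ih =>
    intro cs hcs h
    have hall : cs.all surv = true := List.all_eq_true.mpr fun V hV => hsurv V (hcs V hV)
    simp only [noSubB, hall, Bool.not_true, Bool.false_or, List.all_eq_true, Bool.or_eq_true,
      decide_eq_true_eq] at h
    by_cases hP : ∃ U ∈ P, U ∉ cs
    · obtain ⟨U, hUP, hUcs⟩ := hP
      have h' := (h U (hS U hUP)).resolve_left hUcs
      have hcs' : ∀ V ∈ cs ++ cs.map (symmDiff U), V ∈ P := by
        intro V hV
        rcases List.mem_append.mp hV with hV | hV
        · exact hcs V hV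
        · obtain ⟨V', hV', rfl⟩ := List.mem_map.mp hV
          exact hclosed U hUP V' (hcs V' hV')
      have hlt := ih (cs ++ cs.map (symmDiff U)) hcs' h'
      rw [List.length_append, List.length_map] at hlt
      calc P.card < 2 ^ k * (cs.length + cs.length) := hlt
        _ = 2 ^ (k + 1) * cs.length := by ring
    · simp only [not_exists, not_and, not_not] at hP
      have hsub : P ⊆ cs.toFinset := fun U hU => List.mem_toFinset.mpr (hP U hU)
      have h1 : P.card ≤ cs.length := (Finset.card_le_card hsub).trans (List.toFinset_card_le cs)
      have hpos : 0 < cs.length := List.length_pos_of_mem (hP ∅ h0)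
      have h2 : 2 ≤ 2 ^ (k + 1) := by
        calc (2 : ℕ) = 2 ^ 1 := by norm_num
          _ ≤ 2 ^ (k + 1) := Nat.pow_le_pow_right (by norm_num) (by omega)
      calc P.card ≤ cs.length := h1
        _ < 2 * cs.length := by omega
        _ ≤ 2 ^ (k + 1) * cs.length := Nat.mul_le_mul_right _ h2

end Family

/-! ## The class-group-general cover theorem, subgroup form -/

section CoverNoSub

variable {K : Type*} [Field K] [NumberField K] {n : ℕ}

omit [NumberField K] in
/-- `(∏_U w)(∏_V w) = (∏_{U ∆ V} w)·(∏_{U ∩ V} w)²` in a commutative monoid. [folklore] -/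
theorem prod_mul_prod_eq_symmDiff_sq {M : Type*} [CommMonoid M] (w : Fin n → M) (U V : Finset (Fin n)) :
    (∏ i ∈ U, w i) * (∏ i ∈ V, w i) = (∏ i ∈ symmDiff U V, w i) * (∏ i ∈ U ∩ V, w i) ^ 2 := by
  have hu : U ∪ V = symmDiff U V ∪ (U ∩ V) := by
    ext i
    simp only [Finset.mem_union, Finset.mem_symmDiff, Finset.mem_inter]
    tauto
  have hd : Disjoint (symmDiff U V) (U ∩ V) := by
    rw [Finset.disjoint_left]
    intro i hi
    simp only [Finset.mem_symmDiff, Finset.mem_inter] at hi ⊢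
    tauto
  rw [← Finset.prod_union_inter, hu, Finset.prod_union hd, sq, mul_assoc]

/-- **Rank bound of the class-group-general 2-descent from certificates, SUBGROUP form**: as
`mordellWeilRank_le_of_coverSet_cl_lt`, with the count replaced by: the family `W` is independent modulo
squares, `S` lists every admissible class, and the subgroup-sieve search `noSubB (adm ∅ ·) S (s'+1) [∅]`
succeeds; then `rank E(ℚ) ≤ s'`. [cite: Cassels1991LecturesEllipticCurves, §15] -/
theorem mordellWeilRank_le_of_coverSet_cl_noSub {A B C : ℤ}
    (E : WeierstrassCurve ℚ) [E.IsElliptic] (ha₁ : E.a₁ = 0) (ha₂ : E.a₂ = A) (ha₃ : E.a₃ = 0)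
    (ha₄ : E.a₄ = B) (ha₆ : E.a₆ = C) (hirr : Irreducible (MonicCubic.polyQ A B C)) {θ : 𝓞 K}
    (hθ : aeval (algebraMap (𝓞 K) K θ) (MonicCubic.poly A B C) = 0) (h3 : finrank ℚ K = 3)
    {M : 𝓞 K} (hM : M ≠ 0)
    (hgen : Subgroup.closure {c : ClassGroup (𝓞 K) | ∃ (J : Ideal (𝓞 K))
      (hJ : J ∈ (Ideal (𝓞 K))⁰), M ∈ J ∧ ClassGroup.mk0 ⟨J, hJ⟩ = c} = ⊤)
    (hDM : ∀ v : HeightOneSpectrum (𝓞 K),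
      (3 : 𝓞 K) * θ ^ 2 + 2 * (A : 𝓞 K) * θ + (B : 𝓞 K) ∈ v.asIdeal → M ∈ v.asIdeal)
    {W : Fin n → 𝓞 K} (hW0 : ∀ j, W j ≠ 0)
    (hW : ∀ u : K, u ≠ 0 →
      (∀ v : HeightOneSpectrum (𝓞 K), M ∉ v.asIdeal → v.valuation K u = 1) →
      ∃ U : Finset (Fin n), IsSquare (u * ∏ j ∈ U, algebraMap (𝓞 K) K (W j)))
    {Wu : Fin 0 → (𝓞 K)ˣ} {adm : Finset (Fin 0) → Finset (Fin n) → Bool} (h0 : adm ∅ ∅ = true)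
    (hadm : ∀ x y : ℚ, y ^ 2 = x ^ 3 + A * x ^ 2 + B * x + C →
      ∀ (T : Finset (Fin 0)) (U : Finset (Fin n)),
        IsSquare ((algebraMap ℚ K x - algebraMap (𝓞 K) K θ) *
          (∏ i ∈ T, algebraMap (𝓞 K) K (Wu i)) * ∏ j ∈ U, algebraMap (𝓞 K) K (W j)) →
        adm T U = true)
    (hind : ∀ U : Finset (Fin n), IsSquare (∏ j ∈ U, algebraMap (𝓞 K) K (W j)) → U = ∅)
    {S : List (Finset (Fin n))} (hSall : ∀ U : Finset (Fin n), adm ∅ U = true → U ∈ S)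
    {s' : ℕ} (hns : noSubB (fun U => adm ∅ U) S (s' + 1) [∅] = true) :
    E.mordellWeilRank ≤ s' := by
  classical
  have hrootK := MonicCubic.theta_rel hθ
  have hF : θ ^ 3 + A * θ ^ 2 + B * θ + C = 0 := by
    apply RingOfIntegers.coe_injective
    simpa only [map_add, map_mul, map_pow, map_intCast, _root_.map_zero] using hrootK
  have hroot : (algebraMap (𝓞 K) K θ) ^ 3 + algebraMap ℚ K E.a₂ * (algebraMap (𝓞 K) K θ) ^ 2 +
      algebraMap ℚ K E.a₄ * algebraMap (𝓞 K) K θ + algebraMap ℚ K E.a₆ = 0 := by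
    rw [ha₂, ha₄, ha₆]
    simpa only [map_intCast] using hrootK
  have hlin := powIndep_algebraMap hirr hθ h3
  have hspan := exists_coords hirr hθ h3
  have hθQ : ∀ q : ℚ, algebraMap ℚ K q ≠ algebraMap (𝓞 K) K θ := ne_of_powIndep hlin
  refine mordellWeilRank_le_of_sqClass_cover_noSub E (algebraMap ℚ K) ha₁ ha₃ hroot hlin hspan
    (coverSet Wu W adm) (one_mem_coverSet Wu W h0) ?_ ?_
  · intro x y hxy
    have hE : y ^ 2 = x ^ 3 + A * x ^ 2 + B * x + C := by
      have h := hxy.left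
      rw [WeierstrassCurve.Affine.equation_iff] at h
      have e₁ : E.toAffine.a₁ = 0 := ha₁
      have e₂ : E.toAffine.a₂ = A := ha₂
      have e₃ : E.toAffine.a₃ = 0 := ha₃
      have e₄ : E.toAffine.a₄ = B := ha₄
      have e₆ : E.toAffine.a₆ = C := ha₆
      rw [e₁, e₂, e₃, e₄, e₆] at h
      linear_combination h
    exact sqClass_mem_coverSet_cl hF hθQ hM hgen hDM hW0 hW hadm hE
  · intro H hHS hH1 hHmul
    -- the class map `U ↦ (∏_U W)·K×²`: multiplicative in `∆`, injective by independence
    have hne : ∀ U : Finset (Fin n), (∏ j ∈ U, algebraMap (𝓞 K) K (W j)) ≠ 0 := fun U =>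
      Finset.prod_ne_zero_iff.mpr fun j _ => RingOfIntegers.coe_ne_zero_iff.mpr (hW0 j)
    have hmulc : ∀ U V : Finset (Fin n), sqClass (∏ j ∈ symmDiff U V, algebraMap (𝓞 K) K (W j)) =
        sqClass (∏ j ∈ U, algebraMap (𝓞 K) K (W j)) * sqClass (∏ j ∈ V, algebraMap (𝓞 K) K (W j)) := by
      intro U V
      refine sqClass_eq_mul_of_mul_mul_eq_sq (hne U) (hne V) (hne (symmDiff U V))
        (z := (∏ j ∈ symmDiff U V, algebraMap (𝓞 K) K (W j)) * ∏ j ∈ U ∩ V, algebraMap (𝓞 K) K (W j)) ?_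
      rw [prod_mul_prod_eq_symmDiff_sq (fun j => algebraMap (𝓞 K) K (W j)) U V]
      ring
    have hinj : ∀ U V : Finset (Fin n), sqClass (∏ j ∈ U, algebraMap (𝓞 K) K (W j)) =
        sqClass (∏ j ∈ V, algebraMap (𝓞 K) K (W j)) → U = V := by
      intro U V hUV
      have h1 : sqClass (∏ j ∈ symmDiff U V, algebraMap (𝓞 K) K (W j)) = 1 := by
        rw [hmulc, hUV, SqUnits.mul_self]
      obtain ⟨u, hu⟩ := (sqClass_eq_one_iff (hne (symmDiff U V))).mp h1
      have hsq : IsSquare (∏ j ∈ symmDiff U V, algebraMap (𝓞 K) K (W j)) := ⟨u, by rw [hu, pow_two]⟩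
      exact symmDiff_eq_bot.mp (hind _ hsq)
    have hcov : ∀ h ∈ H, ∃ U : Finset (Fin n), adm ∅ U = true ∧
        sqClass (∏ j ∈ U, algebraMap (𝓞 K) K (W j)) = h := by
      intro h hh
      obtain ⟨p, hp, rfl⟩ := Finset.mem_image.mp (hHS hh)
      have hp1 : p.1 = ∅ := Finset.eq_empty_of_isEmpty p.1
      refine ⟨p.2, ?_, ?_⟩
      · have := (Finset.mem_filter.mp hp).2
        rwa [hp1] at this
      · rw [hp1, Finset.prod_empty, one_mul]
    let P : Finset (Finset (Fin n)) := Finset.univ.filter (fun U => adm ∅ U = true ∧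
      sqClass (∏ j ∈ U, algebraMap (𝓞 K) K (W j)) ∈ H)
    have hHP : H.card ≤ P.card := by
      have hsub : H ⊆ P.image (fun U => sqClass (∏ j ∈ U, algebraMap (𝓞 K) K (W j))) := by
        intro h hh
        obtain ⟨U, hU, rfl⟩ := hcov h hh
        exact Finset.mem_image.mpr ⟨U, Finset.mem_filter.mpr ⟨Finset.mem_univ _, hU, hh⟩, rfl⟩
      exact (Finset.card_le_card hsub).trans Finset.card_image_le
    have hP0 : (∅ : Finset (Fin n)) ∈ P := by
      refine Finset.mem_filter.mpr ⟨Finset.mem_univ _, h0, ?_⟩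
      have h11 : sqClass (1 : K) = 1 := by simpa only [mul_one] using sqClass_mul_self (1 : K)
      rw [Finset.prod_empty, h11]
      exact hH1
    have hPs : ∀ U ∈ P, adm ∅ U = true := fun U hU => (Finset.mem_filter.mp hU).2.1
    have hPS : ∀ U ∈ P, U ∈ S := fun U hU => hSall U (hPs U hU)
    have hPc : ∀ U ∈ P, ∀ V ∈ P, symmDiff U V ∈ P := by
      intro U hU V hV
      have hUV : sqClass (∏ j ∈ symmDiff U V, algebraMap (𝓞 K) K (W j)) ∈ H := by
        rw [hmulc]
        exact hHmul _ (Finset.mem_filter.mp hU).2.2 _ (Finset.mem_filter.mp hV).2.2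
      obtain ⟨U', hU', hcls⟩ := hcov _ hUV
      have hUU : U' = symmDiff U V := hinj _ _ hcls
      refine Finset.mem_filter.mpr ⟨Finset.mem_univ _, ?_, hUV⟩
      rwa [hUU] at hU'
    have hlt := card_lt_of_noSubB (fun U => adm ∅ U) S P hP0 hPs hPS hPc (s' + 1) [∅]
      (fun V hV => by rw [List.mem_singleton.mp hV]; exact hP0) hns
    simp only [List.length_singleton, mul_one] at hlt
    exact lt_of_le_of_lt hHP hlt

end CoverNoSub

/-! ## Kernel sanity checks: sixteen classes (`n = 4`) -/

section Sanity

/-- All sixteen subsets of `Fin 4`, listed. [folklore] -/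
def sanityS4 : List (Finset (Fin 4)) := (List.finRange 4).sublists.map List.toFinset

/-- The full group of sixteen classes contains subgroups of order eight: the search with `k = 3` fails. -/
example : noSubB (fun _ => true) sanityS4 3 [∅] = false := by decide +kernel

/-- Killing the classes `{0}`, `{1}`, `{0, 1}` meets every subgroup of order eight: the search succeeds
(`rank ≤ 2` from THREE kills, where the count would need nine). -/
example : noSubB (fun U => !(U == {0} || U == {1} || U == {0, 1})) sanityS4 3 [∅] = true := by
  decide +kernel

/-- Killing only `{0}` and `{1}` does not: four subgroups of order eight avoid both. -/
example : noSubB (fun U => !(U == {0} || U == {1})) sanityS4 3 [∅] = false := by decide +kernel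

end Sanity

end Summit.BirchSwinnertonDyer.BirchSwinnertonDyer.Rank2Observatory.TwoDescCl

end
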